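import Literature.Topology.FourManifolds.OrientedConnectedSumSphereSelf
import Literature.Topology.FourManifolds.HomotopySpheresGroup
import HarnessLib

/-!
# `M # Sⁿ = M` for oriented connected sums, all `n ≥ 1`: proof of `isOrientedConnectedSum_sphere_self`

Sibling proofs file of `OrientedConnectedSumSphereSelf.lean` (the oriented standard model of
`X # Sⁿ = X` in dimension `n ≥ 2`, `Literature.Topology.FourManifolds.isOrientedConnectedSum_sphere_self_of_two_le`). This file
removes the hypothesis `2 ≤ n` and DISCHARGES the named fact `Literature.Topology.FourManifolds.isOrientedConnectedSum_sphere_self`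
(`HomotopySpheresGroup.lean`; Kervaire–Milnor, *Groups of homotopy spheres I* (1963), Lemma 2.1,
p. 505: "The sphere `Sⁿ` serves as identity element"; Kosinski, *Differential Manifolds* (1993),
VI.(1.3)), leaf (vi) of the decomposition of Kervaire–Milnor's Theorem 1.1
(`Literature.Topology.FourManifolds.exists_commGroup_homotopySphereClass`):

* `Literature.isOrientedConnectedSum_sphere_self_holds : isOrientedConnectedSum_sphere_self` — a closed
  connected oriented smooth `n`-manifold `(M, oM)`, `n ≠ 0`, is an oriented connected sum of
  `(M, oM)` and `(𝕊ⁿ, oS)` (third slot `(M, oM)` itself) for every orientation `oS` of `𝕊ⁿ`;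
  in fact `Literature.Topology.FourManifolds.isOrientedConnectedSum_sphere_self_of_ne_zero` proves this for every Hausdorff
  smooth `n`-manifold carrying an orientation (compactness, second countability and
  connectedness are not used).

## What changes relative to the `n ≥ 2` file

There, the two gluing maps `jA = ι ∘ α`, `jB = ι ∘ β` of the standard model were shown orientation
preserving by Hirsch's one-point criterion, which needs the punctured pieces `M ∖ {i₁ 0}` and
`Sⁿ ∖ {-v}` to be connected — true for `n ≥ 2` by `Literature.Topology.FourManifolds.connectedSpace_puncture_of_isImmersion`.
Here:

1. *`jA` preserves orientation, pointwise* (§3): near a point of the chart domain,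
   `jA = i₁ ∘ h ∘ Φ` with the puncture expansion `h = radialMap η`; the Jacobian of a radial map
   `z ↦ (φ ‖z‖ / ‖z‖) z` is `(φ r / r)ⁿ⁻¹ φ' r` (`Literature.Topology.FourManifolds.det_fderiv_radialMap`, from the rank-one
   determinant formula `Literature.Topology.FourManifolds.det_smul_id_add_smulRight`), and the puncture profile `η` is positive
   with positive derivative (the tree's `Literature.Topology.FourManifolds.exists_hasDerivAt_punctureProfile`), so `det dh > 0`
   (`Literature.Topology.FourManifolds.det_fderiv_punctureExpansion_pos`); with `Φ` carrying `oX` to `o₀` and `i₁` carrying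
   `o₀` back to `oX`, the chain rule (`Literature.Topology.FourManifolds.orientationAt_comp`) gives the claim at points of the
   chart domain, and elsewhere `jA` is the inclusion. No connectedness is needed.
2. *`Sⁿ ∖ {-v}` is connected for every `n`* (§2, `Literature.Topology.FourManifolds.isConnected_compl_singleton_sphere`: it is
   the image of `ℝⁿ` under the inverse stereographic chart), so the one-point argument for `β`
   of the `n ≥ 2` file (`jB = jA ∘ K` on the overlap, with Kervaire–Milnor's identification `K`
   orientation preserving) runs for all `n ≥ 1` (§4).

## References

* M. Kervaire, J. Milnor, *Groups of homotopy spheres I*, Ann. of Math. (2) 77 (1963), §2,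
  Lemma 2.1, p. 505. [KervaireMilnorAnnals1963] / [KervaireMilnor1963]
* A. Kosinski, *Differential Manifolds*, Academic Press (1993), Ch. VI §1, (1.3). [Kosinski1993]
* M. W. Hirsch, *Differential Topology*, GTM 33 (1976), Ch. 4 §4, p. 101. [HirschDT1976]
-/

open scoped Manifold ContDiff Topology RealInnerProductSpace
open Set Module Function Filter OpenPartialHomeomorph Metric

noncomputable section

namespace Literature.Topology.FourManifolds

/-! ### The puncture expansion preserves orientation: `det dh > 0` -/

section RadialDet

variable {n : ℕ}

/-- Local notation: `𝔼 n` is the model Euclidean space `EuclideanSpace ℝ (Fin n)`. -/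
local notation "𝔼 " n:arg => EuclideanSpace ℝ (Fin n)

/-- **The derivative of a radial map** `z ↦ (φ ‖z‖ / ‖z‖) • z` at `z ≠ 0` is a scalar plus a
rank-one map: `d(radialMap φ)_z = (φ r / r) • id + g' ⊗ z` with `g' z = φ' r - φ r / r`
(`r = ‖z‖`, `φ' r` the derivative of the profile). [folklore] -/
theorem exists_hasFDerivAt_radialMap {φ : ℝ → ℝ} {d : ℝ} {z : 𝔼 n} (hz : z ≠ 0)
    (hφ : HasDerivAt φ d ‖z‖) :
    ∃ g' : (𝔼 n) →L[ℝ] ℝ, g' z = d - φ ‖z‖ * ‖z‖⁻¹ ∧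
      HasFDerivAt (radialMap φ : 𝔼 n → 𝔼 n)
        ((φ ‖z‖ * ‖z‖⁻¹) • ContinuousLinearMap.id ℝ (𝔼 n) + g'.smulRight z) z := by
  have hN := hasFDerivAt_norm_of_ne_zero hz
  have hn0 : ‖z‖ ≠ 0 := norm_ne_zero_iff.2 hz
  have hinv : HasFDerivAt (fun y : 𝔼 n => ‖y‖⁻¹)
      ((ContinuousLinearMap.toSpanSingleton ℝ (-(‖z‖ ^ 2)⁻¹)).comp (‖z‖⁻¹ • innerSL ℝ z)) z :=
    (hasFDerivAt_inv hn0).comp z hN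
  have hcomp : HasFDerivAt (fun y : 𝔼 n => φ ‖y‖) ((ContinuousLinearMap.toSpanSingleton ℝ d).comp
      (‖z‖⁻¹ • innerSL ℝ z)) z := by
    have h := hφ.hasFDerivAt.comp z hN
    exact h
  have hg := hcomp.mul hinv
  refine ⟨_, ?_, hg.smul (hasFDerivAt_id z)⟩
  simp only [_root_.add_apply, _root_.smul_apply, ContinuousLinearMap.comp_apply,
    ContinuousLinearMap.toSpanSingleton_apply, innerSL_apply_apply, real_inner_self_eq_norm_sq,
    smul_eq_mul]
  field_simp
  ring

/-- **The Jacobian determinant of a radial map** `z ↦ (φ ‖z‖ / ‖z‖) • z` at `z ≠ 0` is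
`(φ r / r)ⁿ⁻¹ φ' r` (eigenvalue `φ r / r` on `z^⊥`, `φ' r` along `z`). [folklore] -/
theorem det_fderiv_radialMap (hn : n ≠ 0) {φ : ℝ → ℝ} {d : ℝ} {z : 𝔼 n} (hz : z ≠ 0)
    (hφ : HasDerivAt φ d ‖z‖) (hφ0 : φ ‖z‖ ≠ 0) :
    LinearMap.det ((fderiv ℝ (radialMap φ : 𝔼 n → 𝔼 n) z : (𝔼 n) →L[ℝ] (𝔼 n)) :
      (𝔼 n) →ₗ[ℝ] (𝔼 n)) = (φ ‖z‖ * ‖z‖⁻¹) ^ (n - 1) * d := by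
  have hn0 : ‖z‖ ≠ 0 := norm_ne_zero_iff.2 hz
  obtain ⟨g', hg'z, hd⟩ := exists_hasFDerivAt_radialMap hz hφ
  rw [hd.fderiv]
  set c : ℝ := φ ‖z‖ * ‖z‖⁻¹ with hc_def
  have hc : c ≠ 0 := mul_ne_zero hφ0 (inv_ne_zero hn0)
  have hcoe : ((c • ContinuousLinearMap.id ℝ (𝔼 n) + g'.smulRight z : (𝔼 n) →L[ℝ] (𝔼 n)) :
      (𝔼 n) →ₗ[ℝ] (𝔼 n)) = c • LinearMap.id + (g' : (𝔼 n) →ₗ[ℝ] ℝ).smulRight z := by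
    ext w
    rfl
  rw [hcoe, det_smul_id_add_smulRight hn hc]
  have hg'z' : (g' : (𝔼 n) →ₗ[ℝ] ℝ) z = d - φ ‖z‖ * ‖z‖⁻¹ := hg'z
  rw [hg'z', hc_def]
  ring

/-- **The puncture expansion preserves orientation**: its Jacobian determinant at `z ≠ 0` is
positive (`n ≠ 0`). [folklore] -/
theorem det_fderiv_punctureExpansion_pos (hn : n ≠ 0) {z : 𝔼 n} (hz : z ≠ 0) :
    0 < LinearMap.det ((fderiv ℝ (punctureExpansion : 𝔼 n → 𝔼 n) z : (𝔼 n) →L[ℝ] (𝔼 n)) :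
      (𝔼 n) →ₗ[ℝ] (𝔼 n)) := by
  have hr : 0 < ‖z‖ := norm_pos_iff.2 hz
  obtain ⟨d, hd, hφ⟩ := exists_hasDerivAt_punctureProfile hr
  have hφ0 : 0 < punctureProfile ‖z‖ := punctureProfile_pos hr
  rw [punctureExpansion, det_fderiv_radialMap hn hz hφ hφ0.ne']
  exact mul_pos (pow_pos (mul_pos hφ0 (inv_pos.2 hr)) _) hd

/-- The puncture expansion is differentiable away from the origin. [folklore] -/
theorem differentiableAt_punctureExpansion {z : 𝔼 n} (hz : z ≠ 0) :
    DifferentiableAt ℝ (punctureExpansion : 𝔼 n → 𝔼 n) z :=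
  (contDiffAt_radialMap hz (contDiffAt_punctureProfile (norm_pos_iff.2 hz))).differentiableAt
    (by simp)

end RadialDet

/-! ### The sphere minus a point is connected -/

/-- `S ∖ {w}` is connected for the unit sphere `S` of an inner product space of dimension `n + 1`
(all `n`): it is the source of the stereographic chart from `w`, the continuous image of `ℝⁿ`.
[folklore] -/
theorem isConnected_compl_singleton_sphere {V : Type*} [NormedAddCommGroup V]
    [InnerProductSpace ℝ V] {n : ℕ} [Fact (finrank ℝ V = n + 1)] (w : sphere (0 : V) 1) :
    IsConnected ({w}ᶜ : Set (sphere (0 : V) 1)) := by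
  rw [← stereographic'_source (n := n) w, ← (stereographic' n w).symm_image_target_eq_source]
  have ht : (stereographic' n w).target = univ := stereographic'_target w
  have hc : ContinuousOn (stereographic' n w).symm univ := ht ▸ (stereographic' n w).continuousOn_symm
  rw [ht]
  exact isConnected_univ.image _ hc

namespace ConnectedSumSphereData

variable {V : Type*} [NormedAddCommGroup V] [InnerProductSpace ℝ V] {n : ℕ}
  [Fact (finrank ℝ V = n + 1)] {X : Type*} [TopologicalSpace X] [T2Space X]
  [ChartedSpace (EuclideanSpace ℝ (Fin n)) X] [IsManifold (𝓡 n) ∞ X]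
  (D : ConnectedSumSphereData V n X)

omit [T2Space X] [IsManifold (𝓡 n) ∞ X] in
/-- `S ∖ {i₂ 0} = S ∖ {-v}` is connected (all `n`). [folklore] -/
theorem connectedSpace_punctureB' : ConnectedSpace ↥(puncture D.i₂) := by
  have h := isConnected_compl_singleton_sphere (n := n) (-D.v)
  rw [← D.i₂_zero] at h
  exact isConnected_iff_connectedSpace.mp h

/-! #### `jA` preserves orientation, pointwise (all `n ≥ 1`) -/

omit [InnerProductSpace ℝ V] [Fact (finrank ℝ V = n + 1)] [T2Space X] [IsManifold (𝓡 n) ∞ X] in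
/-- The chart `Φ` is differentiable on its source. [folklore] -/
theorem mdifferentiableAt_Φ {x : X} (hx : x ∈ D.Φ.source) : MDifferentiableAt (𝓡 n) (𝓡 n) D.Φ x :=
  (D.contMDiffOn_Φ.contMDiffAt (D.Φ.open_source.mem_nhds hx)).mdifferentiableAt (by simp)

omit [InnerProductSpace ℝ V] [Fact (finrank ℝ V = n + 1)] [T2Space X] [IsManifold (𝓡 n) ∞ X] in
/-- `d(Φ)_x ∘ d(i₁)_{Φ x} = id` on the source of `Φ`: the Jacobians multiply to `1`. [folklore] -/
theorem det_mfderiv_Φ_mul {x : X} (hx : x ∈ D.Φ.source) :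
    LinearMap.det (M := EuclideanSpace ℝ (Fin n)) (mfderiv (𝓡 n) (𝓡 n) D.Φ x).toLinearMap *
      LinearMap.det (M := EuclideanSpace ℝ (Fin n))
        (mfderiv (𝓡 n) (𝓡 n) D.i₁ (D.Φ x)).toLinearMap = 1 := by
  apply det_mul_det_eq_one_of_comp_eq_id
  have hid : (D.Φ : X → EuclideanSpace ℝ (Fin n)) ∘ D.i₁ = id := funext fun y => D.Φ_i₁ y
  have hv : D.i₁ (D.Φ x) = x := D.i₁_Φ hx
  have h := mfderiv_comp (D.Φ x) (I := 𝓡 n) (I' := 𝓡 n) (I'' := 𝓡 n)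
    (hv ▸ D.mdifferentiableAt_Φ hx) (D.mdifferentiableAt_i₁ (D.Φ x))
  rw [hid, mfderiv_id] at h
  rw [hv] at h
  exact h.symm

omit [InnerProductSpace ℝ V] [Fact (finrank ℝ V = n + 1)] [T2Space X] in
/-- **The chart `Φ` carries `oX x` to `o₀`** exactly when its Jacobian is positive, at points of
its source, when `i₁ = Φ⁻¹` preserves `(o₀, oX)`. [folklore] -/
theorem orientationAt_Φ {o₀ : Orientation ℝ (EuclideanSpace ℝ (Fin n)) (Fin (finrank ℝ (EuclideanSpace ℝ (Fin n))))}
    {oX : SmoothOrientation (𝓡 n) X}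
    (h₁ : IsOrientationPreserving (SmoothOrientation.modelSpace o₀) oX D.i₁) {x : X}
    (hx : x ∈ D.Φ.source) :
    (SmoothOrientation.modelSpace o₀ (D.Φ x) = oX x ↔
      0 < LinearMap.det (M := EuclideanSpace ℝ (Fin n)) (mfderiv (𝓡 n) (𝓡 n) D.Φ x).toLinearMap) := by
  have hmul := D.det_mfderiv_Φ_mul hx
  have ha0 := left_ne_zero_of_mul_eq_one hmul
  have hb0 := right_ne_zero_of_mul_eq_one hmul
  have hsign := (mul_pos_iff_pos_iff_pos ha0 hb0).mp (by rw [hmul]; exact one_pos)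
  have h := h₁ (D.Φ x)
  rw [D.i₁_Φ hx] at h
  simp only [SmoothOrientation.modelSpace_apply] at h ⊢
  rw [eq_comm, h]
  exact hsign.symm

omit [InnerProductSpace ℝ V] [Fact (finrank ℝ V = n + 1)] [IsManifold (𝓡 n) ∞ X] in
/-- On the source of `Φ`, `jA = i₁ ∘ h ∘ Φ` (`h` the puncture expansion). [folklore] -/
theorem jA_eventuallyEq_of_mem {a : ↥(puncture D.i₁)} (ha : (a : X) ∈ D.Φ.source) :
    D.jA =ᶠ[𝓝 a] D.i₁ ∘ ((punctureExpansion : EuclideanSpace ℝ (Fin n) → _) ∘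
      (fun a' : ↥(puncture D.i₁) => D.Φ a')) := by
  have ho : IsOpen {a' : ↥(puncture D.i₁) | (a' : X) ∈ D.Φ.source} :=
    D.Φ.open_source.preimage continuous_subtype_val
  filter_upwards [ho.mem_nhds ha] with a' ha'
  rw [D.jA_apply, coe_α, chartTransport_of_mem _ ha']
  rfl

omit [InnerProductSpace ℝ V] [Fact (finrank ℝ V = n + 1)] in
/-- **`jA` carries `oX a` to `oX (jA a)` exactly when its Jacobian is positive**, at every point
(`n ≠ 0`, `i₁` preserving `(o₀, oX)`): near a point of the source of `Φ`, `jA = i₁ ∘ h ∘ Φ` with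
`Φ` carrying `oX` to `o₀`, the puncture expansion `h` carrying `o₀` to `o₀`
(`det dh > 0`, `det_fderiv_punctureExpansion_pos`) and `i₁` carrying `o₀` to `oX`; elsewhere
`jA` is the inclusion. [folklore] -/
theorem orientationAt_jA (hn : n ≠ 0)
    {o₀ : Orientation ℝ (EuclideanSpace ℝ (Fin n)) (Fin (finrank ℝ (EuclideanSpace ℝ (Fin n))))}
    {oX : SmoothOrientation (𝓡 n) X}
    (h₁ : IsOrientationPreserving (SmoothOrientation.modelSpace o₀) oX D.i₁)
    (a : ↥(puncture D.i₁)) :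
    (oX (D.jA a) = oX a ↔ 0 < LinearMap.det (M := EuclideanSpace ℝ (Fin n))
      (mfderiv (𝓡 n) (𝓡 n) D.jA a).toLinearMap) := by
  by_cases ha : (a : X) ∈ D.Φ.source
  · -- `jA = i₁ ∘ h ∘ Φ` near `a`
    set x : X := (a : X) with hx_def
    have hz : D.Φ x ≠ 0 := D.Φ_ne_zero ha a.2
    -- `Φ ∘ val` at `a`
    have hΦd : MDifferentiableAt (𝓡 n) (𝓡 n) (fun a' : ↥(puncture D.i₁) => D.Φ a') a :=
      (D.mdifferentiableAt_Φ ha).comp a (mdifferentiableAt_subtype_val a)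
    have hΦderiv : mfderiv (𝓡 n) (𝓡 n) (fun a' : ↥(puncture D.i₁) => D.Φ a') a =
        mfderiv (𝓡 n) (𝓡 n) D.Φ x := by
      have h := mfderiv_comp a (I := 𝓡 n) (I' := 𝓡 n) (I'' := 𝓡 n) (D.mdifferentiableAt_Φ ha)
        (mdifferentiableAt_subtype_val a)
      rw [mfderiv_subtype_val] at h
      rw [show (fun a' : ↥(puncture D.i₁) => D.Φ a') = D.Φ ∘ Subtype.val from rfl, h]
      ext v
      rfl
    have hΦ0 := left_ne_zero_of_mul_eq_one (D.det_mfderiv_Φ_mul ha)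
    have hΦ : (SmoothOrientation.modelSpace o₀ ((fun a' : ↥(puncture D.i₁) => D.Φ a') a) =
        (oX.restrict (puncture D.i₁)) a ↔ 0 < LinearMap.det (M := EuclideanSpace ℝ (Fin n))
          (mfderiv (𝓡 n) (𝓡 n) (fun a' : ↥(puncture D.i₁) => D.Φ a') a).toLinearMap) := by
      rw [hΦderiv]
      exact D.orientationAt_Φ h₁ ha
    rw [← hΦderiv] at hΦ0
    -- `h` at `Φ x`
    have hhd : MDifferentiableAt (𝓡 n) (𝓡 n) (punctureExpansion : EuclideanSpace ℝ (Fin n) → _)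
        (D.Φ x) := (differentiableAt_punctureExpansion hz).mdifferentiableAt
    have hhdet : 0 < LinearMap.det (M := EuclideanSpace ℝ (Fin n)) (mfderiv (𝓡 n) (𝓡 n)
        (punctureExpansion : EuclideanSpace ℝ (Fin n) → _) (D.Φ x)).toLinearMap := by
      rw [mfderiv_eq_fderiv]
      exact det_fderiv_punctureExpansion_pos hn hz
    have hh : (SmoothOrientation.modelSpace o₀ (punctureExpansion (D.Φ x)) =
        SmoothOrientation.modelSpace o₀ (D.Φ x) ↔ 0 < LinearMap.det
          (M := EuclideanSpace ℝ (Fin n)) (mfderiv (𝓡 n) (𝓡 n)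
            (punctureExpansion : EuclideanSpace ℝ (Fin n) → _) (D.Φ x)).toLinearMap) :=
      iff_of_true rfl hhdet
    have hc1 := orientationAt_comp (oM := oX.restrict (puncture D.i₁))
      (oN := SmoothOrientation.modelSpace o₀) (oP := SmoothOrientation.modelSpace o₀)
      (f := fun a' : ↥(puncture D.i₁) => D.Φ a') (g := punctureExpansion) (x := a)
      hΦd hhd hΦ0 hhdet.ne' hΦ hh
    have hc1d : MDifferentiableAt (𝓡 n) (𝓡 n) ((punctureExpansion : EuclideanSpace ℝ (Fin n) → _) ∘
        fun a' : ↥(puncture D.i₁) => D.Φ a') a := hhd.comp a hΦd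
    have hc10 : LinearMap.det (M := EuclideanSpace ℝ (Fin n)) (mfderiv (𝓡 n) (𝓡 n)
        ((punctureExpansion : EuclideanSpace ℝ (Fin n) → _) ∘
          fun a' : ↥(puncture D.i₁) => D.Φ a') a).toLinearMap ≠ 0 := by
      have hcomp : mfderiv (𝓡 n) (𝓡 n) ((punctureExpansion : EuclideanSpace ℝ (Fin n) → _) ∘
          fun a' : ↥(puncture D.i₁) => D.Φ a') a = (mfderiv (𝓡 n) (𝓡 n)
            (punctureExpansion : EuclideanSpace ℝ (Fin n) → _) (D.Φ x)).comp
              (mfderiv (𝓡 n) (𝓡 n) (fun a' : ↥(puncture D.i₁) => D.Φ a') a) :=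
        mfderiv_comp a hhd hΦd
      rw [hcomp]
      have hdet' : LinearMap.det (M := EuclideanSpace ℝ (Fin n)) ((mfderiv (𝓡 n) (𝓡 n)
          (punctureExpansion : EuclideanSpace ℝ (Fin n) → _) (D.Φ x)).comp
            (mfderiv (𝓡 n) (𝓡 n) (fun a' : ↥(puncture D.i₁) => D.Φ a') a)).toLinearMap =
          LinearMap.det (M := EuclideanSpace ℝ (Fin n)) (mfderiv (𝓡 n) (𝓡 n)
            (punctureExpansion : EuclideanSpace ℝ (Fin n) → _) (D.Φ x)).toLinearMap *
          LinearMap.det (M := EuclideanSpace ℝ (Fin n))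
            (mfderiv (𝓡 n) (𝓡 n) (fun a' : ↥(puncture D.i₁) => D.Φ a') a).toLinearMap :=
        LinearMap.det_comp (M := EuclideanSpace ℝ (Fin n)) _ _
      rw [hdet']
      exact mul_ne_zero hhdet.ne' hΦ0
    -- `i₁` at `h (Φ x)`
    have hi₁d := D.mdifferentiableAt_i₁ (punctureExpansion (D.Φ x))
    have hi₁0 := det_mfderiv_ne_zero_of_isSmoothEmbedding D.isSmoothEmbedding_i₁
      (D.source_eq ▸ D.Φ.open_source) (punctureExpansion (D.Φ x))
    have hc2 := orientationAt_comp (oM := oX.restrict (puncture D.i₁))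
      (oN := SmoothOrientation.modelSpace o₀) (oP := oX)
      (f := (punctureExpansion : EuclideanSpace ℝ (Fin n) → _) ∘ fun a' : ↥(puncture D.i₁) => D.Φ a')
      (g := D.i₁) (x := a) hc1d hi₁d hc10 hi₁0 hc1 (h₁ (punctureExpansion (D.Φ x)))
    rw [(D.jA_eventuallyEq_of_mem ha).mfderiv_eq, (D.jA_eventuallyEq_of_mem ha).self_of_nhds]
    simp only [SmoothOrientation.restrict_apply] at hc2
    exact hc2
  · -- far from the disc: `jA` is the inclusion
    have hfar : (a : X) ∈ D.Φ.source → 3 / 4 < ‖D.Φ a‖ := fun h => absurd h ha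
    rw [D.mfderiv_jA_of_far hfar, D.jA_eq_coe (fun h => absurd h ha), ContinuousLinearMap.coe_id]
    exact iff_of_true rfl (lt_of_lt_of_eq one_pos LinearMap.det_id.symm)

omit [InnerProductSpace ℝ V] [Fact (finrank ℝ V = n + 1)] in
/-- **`jA : (X ∖ {i₁ 0}, oX|) → (X, oX)` is orientation preserving** (`n ≠ 0`, `i₁` preserving
`(o₀, oX)`; no connectedness needed). [folklore] -/
theorem isOrientationPreserving_jA' (hn : n ≠ 0)
    {o₀ : Orientation ℝ (EuclideanSpace ℝ (Fin n)) (Fin (finrank ℝ (EuclideanSpace ℝ (Fin n))))}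
    {oX : SmoothOrientation (𝓡 n) X}
    (h₁ : IsOrientationPreserving (SmoothOrientation.modelSpace o₀) oX D.i₁) :
    IsOrientationPreserving (oX.restrict (puncture D.i₁)) oX D.jA :=
  fun a => D.orientationAt_jA hn h₁ a

/-! #### `β` and `jB` preserve orientation (all `n ≥ 1`) -/

/-- **`β : S ∖ {-v} ≅ i₁(B(0, 1))` is orientation preserving** from `oS|` to `oX|` when `i₁`
preserves and `i₂` reverses the orientations `(o₀, ·)`, for every `n ≠ 0` (the argument of
`isOrientationPreserving_β` with the pointwise `isOrientationPreserving_jA'` and the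
connectedness of `S ∖ {-v} ≅ ℝⁿ`, `connectedSpace_punctureB'`, valid in all dimensions).
[cite: KervaireMilnor1963, §2] -/
theorem isOrientationPreserving_β' (hn : n ≠ 0)
    {o₀ : Orientation ℝ (EuclideanSpace ℝ (Fin n)) (Fin (finrank ℝ (EuclideanSpace ℝ (Fin n))))}
    {oX : SmoothOrientation (𝓡 n) X} {oS : SmoothOrientation (𝓡 n) (sphere (0 : V) 1)}
    (h₁ : IsOrientationPreserving (SmoothOrientation.modelSpace o₀) oX D.i₁)
    (h₂ : IsOrientationReversing (SmoothOrientation.modelSpace o₀) oS D.i₂) :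
    D.β.IsOrientationPreserving (oS.restrict (puncture D.i₂)) (oX.restrict D.Uβ) := by
  haveI := D.connectedSpace_punctureB'
  haveI : Nontrivial (EuclideanSpace ℝ (Fin n)) :=
    Module.nontrivial_of_finrank_pos (R := ℝ) (by rw [finrank_euclideanSpace_fin]; omega)
  obtain ⟨w₀, hw₀⟩ := exists_norm_eq (EuclideanSpace ℝ (Fin n)) (show (0 : ℝ) ≤ 1 / 2 by norm_num)
  have hw0 : 0 < ‖w₀‖ := by rw [hw₀]; norm_num
  have hw1 : ‖w₀‖ < 1 := by rw [hw₀]; norm_num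
  have hb₀ : D.i₂ w₀ ∈ puncture D.i₂ := D.i₂_mem_puncture (norm_pos_iff.1 hw0)
  set b₀ : ↥(puncture D.i₂) := ⟨D.i₂ w₀, hb₀⟩ with hb₀_def
  refine Diffeomorph.isOrientationPreserving_of_orientationAt D.β (by simp) _ _ (x := b₀) ?_
  rw [D.mfderiv_β]
  simp only [SmoothOrientation.restrict_apply]
  show (oX (D.jB b₀) = oS (D.i₂ w₀) ↔ _)
  have hT : b₀ ∈ D.T := D.i₂_mem_T hw0 hw1 hb₀
  obtain ⟨a₁, -, -⟩ := D.exists_far hn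
  have hev : D.jB =ᶠ[𝓝 b₀] D.jA ∘ D.K a₁ := by
    filter_upwards [D.isOpen_T.mem_nhds hT] with b hb
    exact D.jB_eq_jA_K hb
  have hKev : ∀ᶠ b in 𝓝 b₀, ((D.K a₁ b : ↥(puncture D.i₁)) : X) = D.k b := by
    filter_upwards [D.isOpen_T.mem_nhds hT] with b hb
    exact D.coe_K hb
  obtain ⟨hk, hkd, hk0⟩ := D.orientationAt_k hn h₁ h₂ hw0 hw1
  have hKd : MDifferentiableAt (𝓡 n) (𝓡 n) (D.K a₁) b₀ :=
    mdifferentiableAt_opens_of_eventuallyEq hKev hkd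
  have hKderiv : mfderiv (𝓡 n) (𝓡 n) (D.K a₁) b₀ = mfderiv (𝓡 n) (𝓡 n) D.k (D.i₂ w₀) :=
    mfderiv_opens_eq_of_eventuallyEq hKev hkd
  have hKb₀ : ((D.K a₁ b₀ : ↥(puncture D.i₁)) : X) = D.k (D.i₂ w₀) := D.coe_K hT
  have hK : ((oX.restrict (puncture D.i₁)) (D.K a₁ b₀) = (oS.restrict (puncture D.i₂)) b₀ ↔
      0 < LinearMap.det (M := EuclideanSpace ℝ (Fin n))
        (mfderiv (𝓡 n) (𝓡 n) (D.K a₁) b₀).toLinearMap) := by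
    simp only [SmoothOrientation.restrict_apply]
    rw [hKb₀, hKderiv]
    exact hk
  have hK0 : LinearMap.det (M := EuclideanSpace ℝ (Fin n))
      (mfderiv (𝓡 n) (𝓡 n) (D.K a₁) b₀).toLinearMap ≠ 0 := by
    rw [hKderiv]; exact hk0
  have hjA := D.isOrientationPreserving_jA' hn h₁ (D.K a₁ b₀)
  have hcomp := orientationAt_comp (oM := oS.restrict (puncture D.i₂))
    (oN := oX.restrict (puncture D.i₁)) (oP := oX) (f := D.K a₁) (g := D.jA) (x := b₀) hKd
    (D.mdifferentiableAt_jA _) hK0 (D.det_mfderiv_jA_ne_zero _) hK hjA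
  rw [hev.mfderiv_eq]
  have hval : D.jB b₀ = D.jA (D.K a₁ b₀) := D.jB_eq_jA_K hT
  rw [hval]
  simp only [SmoothOrientation.restrict_apply] at hcomp
  exact hcomp

/-- **`jB : (S ∖ {-v}, oS|) → (X, oX)` is orientation preserving** (`n ≠ 0`, `i₁` preserving and
`i₂` reversing `(o₀, ·)`). [cite: KervaireMilnor1963, §2] -/
theorem isOrientationPreserving_jB' (hn : n ≠ 0)
    {o₀ : Orientation ℝ (EuclideanSpace ℝ (Fin n)) (Fin (finrank ℝ (EuclideanSpace ℝ (Fin n))))}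
    {oX : SmoothOrientation (𝓡 n) X} {oS : SmoothOrientation (𝓡 n) (sphere (0 : V) 1)}
    (h₁ : IsOrientationPreserving (SmoothOrientation.modelSpace o₀) oX D.i₁)
    (h₂ : IsOrientationReversing (SmoothOrientation.modelSpace o₀) oS D.i₂) :
    IsOrientationPreserving (oS.restrict (puncture D.i₂)) oX D.jB := by
  intro b
  have h := D.isOrientationPreserving_β' hn h₁ h₂ b
  rw [D.mfderiv_β] at h
  exact h

/-- **`(X, oX)` is the oriented connected sum of itself and `(S, oS)`** along `i₁ = Φ⁻¹`,
`i₂ = σᵥ⁻¹ ∘ S₀` whenever `i₁` preserves and `i₂` reverses `(o₀, ·)`, for every `n ≠ 0` and every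
Hausdorff `X` (no connectedness needed). [cite: KervaireMilnor1963, §2] -/
theorem isOrientedConnectedSum_self' (hn : n ≠ 0)
    {o₀ : Orientation ℝ (EuclideanSpace ℝ (Fin n)) (Fin (finrank ℝ (EuclideanSpace ℝ (Fin n))))}
    (oX : SmoothOrientation (𝓡 n) X) (oS : SmoothOrientation (𝓡 n) (sphere (0 : V) 1))
    (h₁ : IsOrientationPreserving (SmoothOrientation.modelSpace o₀) oX D.i₁)
    (h₂ : IsOrientationReversing (SmoothOrientation.modelSpace o₀) oS D.i₂) :
    IsOrientedConnectedSum oX oS oX :=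
  ⟨D.i₁, D.i₂, o₀, D.jA, D.jB, D.isSmoothEmbedding_i₁, D.isSmoothEmbedding_i₂, h₁, h₂,
    ⟨D.isSmoothEmbedding_jA, D.isOpen_range_jA, D.isSmoothEmbedding_jB, D.isOpen_range_jB,
      D.range_jA_union_range_jB, D.jA_eq_jB_iff⟩,
    D.isOrientationPreserving_jA' hn h₁, D.isOrientationPreserving_jB' hn h₁ h₂⟩

end ConnectedSumSphereData

/-! ### Discharge of `isOrientedConnectedSum_sphere_self` -/

/-- Local notation: `𝔼 n` is the model Euclidean space `EuclideanSpace ℝ (Fin n)`. -/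
local notation "𝔼 " n:arg => EuclideanSpace ℝ (Fin n)

/-- Local notation: `𝕊 n` is the unit sphere in `EuclideanSpace ℝ (Fin (n + 1))`, the standard
`n`-sphere with its Mathlib analytic manifold structure. -/
local notation "𝕊 " n:arg => (Metric.sphere (0 : EuclideanSpace ℝ (Fin (n + 1))) 1)

universe u

/-- **`M # Sⁿ = M` for oriented connected sums** in every dimension `n ≠ 0` and for every Hausdorff
smooth `n`-manifold with an orientation (no compactness or connectedness needed): the oriented
standard model `ConnectedSumSphereData.isOrientedConnectedSum_self'` for data with `i₁`
orientation preserving and the round disc `i₂` orientation reversing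
(`ConnectedSumSphereData.exists_oriented`). (Kervaire–Milnor 1963, Lemma 2.1: "The sphere `Sⁿ`
serves as identity element"; Kosinski VI.(1.3).) [cite: KervaireMilnorAnnals1963, Lemma 2.1 (p. 505)] -/
theorem isOrientedConnectedSum_sphere_self_of_ne_zero {n : ℕ} (hn : n ≠ 0) {M : Type u}
    [TopologicalSpace M] [T2Space M] [ChartedSpace (𝔼 n) M] [IsManifold (𝓡 n) ∞ M] [Nonempty M]
    (oM : SmoothOrientation (𝓡 n) M) (oS : SmoothOrientation (𝓡 n) (𝕊 n)) :
    IsOrientedConnectedSum oM oS oM := by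
  haveI : Fact (finrank ℝ (EuclideanSpace ℝ (Fin (n + 1))) = n + 1) := ⟨finrank_euclideanSpace_fin⟩
  obtain ⟨p⟩ : Nonempty (𝕊 n) := (NormedSpace.sphere_nonempty.mpr zero_le_one).to_subtype
  obtain ⟨D, o₀, h₁, h₂⟩ := ConnectedSumSphereData.exists_oriented (V := 𝔼 (n + 1)) (X := M)
    hn oM oS p
  exact D.isOrientedConnectedSum_self' hn oM oS h₁ h₂

/-- **Discharge** of the named fact `Literature.Topology.FourManifolds.isOrientedConnectedSum_sphere_self`
(`HomotopySpheresGroup.lean`; Kervaire–Milnor, *Groups of homotopy spheres I* (1963), Lemma 2.1,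
p. 505: "The sphere `Sⁿ` serves as identity element"; Kosinski, *Differential Manifolds* (1993),
VI.(1.3)): a closed connected oriented smooth `n`-manifold `(M, oM)`, `n ≠ 0`, is an oriented
connected sum of `(M, oM)` and `(𝕊ⁿ, oS)` for every orientation `oS` of the sphere.
[cite: KervaireMilnorAnnals1963, Lemma 2.1 (p. 505)] [cite: Kosinski1993, Ch. VI §1 (1.3)] -/
theorem isOrientedConnectedSum_sphere_self_holds : isOrientedConnectedSum_sphere_self.{u} := by
  intro n M _ _ _ _ _ _ _ oM oS hn
  exact isOrientedConnectedSum_sphere_self_of_ne_zero hn oM oS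

end Literature.Topology.FourManifolds
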